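import Literature.Barriers.PneNP.RectanglePositivityNoLift
import HarnessLib

/-!
# Barrier (sequel): rectangle bounds PLUS column-wise exact low-degree positivity still do not lift
# to psd contractions — the Frankl–Wilson game tensored with one high-degree parity

Sequel to `Literature.Barriers.PneNP.RectanglePositivityNoLift` (same cell pnp-psdrank, route
`ChebyshevTracialDesign`, crux `TracialDecayExp20` = stmt-PneNP-19878). That file refutes KERNEL-AGNOSTIC
lifting "all rectangles `≥ −ε` ⇒ all dimension-`r` psd-contraction pairs `≥ −C(r)·ε`" with polynomial
`C` (`not_rectangleBoundLifts_poly`), and its `evasions_known (i)` names the natural next hope: in the cell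
every COLUMN `U ↦ W(U,M)` of the design weight is, besides having small rectangle sums, an EXACT
nonnegative functional on squares of cut-side polynomials of degree `≤ dq n/2` (the matching's Grigoriev
pseudo-expectation, knapsack positivity [cite: Grigoriev2001, Lemma 1.4 (PDF p. 8)]; cell brick 84b), while
the column itself has degree `2·dq n` in the cut variables. THIS FILE shows that the TWO hypotheses
together — (P1) column-wise exact positivity on squares of all functions of degree `≤ d` in a block of
Boolean variables in which the kernel has a component of degree `> 2d`, and (P2) all rectangle sums
`≥ −ε` — STILL do not lift with sub-exponential loss, for every `d`: the lifting constant is again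
`≥ C(4p,2p−1)/(4p·C(4p,p−1)) ≥ (3/2)^p/(4p)` in dimension `r = 4p`, uniformly in `d`.

Construction (all proved, axioms standard; `p` prime, `k > 2d`, Layer = the `(2p−1)`-subsets of `[4p]`
from the first file, `{0,1}^k` an auxiliary cube, `u(Z) = (−1)^{|Z|}` its top parity):
* `ldKernel` — `V((A,Z), B) = −[A = B]·u(Z) + ½·[|A ∩ B| = p−1]` on (Layer × {0,1}^k) × Layer.
* (P1) `column_lowDeg_psd` — for every column `B` and every `s` with `Z ↦ s(A,Z)` of degree `≤ d` for each
  `A` (`IsLowDeg`; the `A`-dependence is unrestricted, which makes the hypothesis STRONGER):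
  `Σ_x V(x,B)·s(x)² ≥ 0`, because `s(A,·)²` has degree `≤ 2d < k` and is orthogonal to `u`
  (`sum_parity_mul_sq_eq_zero`, from `sum_parity_mul_chi_mul_chi_eq_zero`: flip a coordinate outside
  `T ∪ T'` [cite: ODonnell2014, Thm. 1.5 (orthonormality of the χ_S) and Fact 1.6 (χ_S·χ_T = χ_{S△T})]), so the
  twisted diagonal is invisible and what remains, `½·Σ_{A ⟂ B} Σ_Z s²`, is nonnegative.
* (P2) `rect_sum_ge` — every rectangle `S ⊆ Layer × {0,1}^k`, `T ⊆ Layer` has `V`-sum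
  `≥ −W₊·C(4p,p−1)`, `W₊ = evenMass k = #{Z : u(Z) = 1}`: per base point only the even fibre of `S` can be
  rewarded, so the sum dominates the FRACTIONAL Frankl–Wilson rectangle `f(A) = #(even fibre of S at A)/W₊`,
  `g = 1_T` of the first file (`frac_rect_sum_ge`, Frankl–Wilson [cite: FranklWilson1981, Thm. 2 and §3]
  + the vertex argument [cite: Rothvoss2017, Lemma 5 (proof, PDF p. 6: fractional rank-1 matrices obey the 0/1 rectangle bound)]).
* `ldProjX` / `contraction_value` — the strategy `X_{(A,Z)} = [u(Z) = 1]·x_A x_Aᵀ/(4p)`, `Y_B = x_B x_Bᵀ/(4p)`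
  (`0 ⪯ · ⪯ I`, `ldProjX_contraction`) has value `−W₊·C(4p,2p−1)`: the Buhrman–Cleve–Wigderson strategy of
  the first file [cite: BuhrmanCleveWigderson1998, Thm. 6 and §3] switched off on the odd fibre — a
  strategy of TOP degree `k` in `Z`, above the positivity range `2d`.
* `RectangleBoundLiftsLowDegPsd C` (the technique class), `rectangleBoundLiftsLowDegPsd_of_lifts`
  (it contains the plain class), `liftConstant_ge` (`C(4p) ≥ C(4p,2p−1)/(4p·C(4p,p−1))` for every prime
  `p` and EVERY `d`, via `k = 2d+1`; `W₊` cancels), `liftConstant_ge_exp` (`≥ (3/2)^p/(4p)`),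
  `not_rectangleBoundLiftsLowDegPsd_poly` (no polynomial `C`).

technique_class: KERNEL-AGNOSTIC ONE-SIDED LIFTING ASSISTED BY PARTIAL-DEGREE EXACT POSITIVITY — any
  argument deriving "(1/r)·Σ W·tr(X_x Y_b) ≥ −C(r)·ε for all dimension-`r` psd-contraction pairs" for an
  ARBITRARY finite kernel `W` on `(α₀ × {0,1}^k) × β` from the two inputs (P1) "each column `W(·,b)` is
  `≥ 0` on `s²` for every `s` of degree `≤ d` in the cube block, `2d < k`" and (P2) "every 0/1 rectangle
  has `W`-sum `≥ −ε`"; formalised as `RectangleBoundLiftsLowDegPsd C`. [cite: Grigoriev2001, Lemma 1.4 (PDF p. 8)]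
  [cite: Paulsen2003, Thm. 3.9 and Thm. 3.11 (exact positivity = complete positivity for commutative algebras — the ε = 0 case that does lift)]
blocks: the repair of the step "NTF / `RectangleDecayBal` (`r = 1`) ⇒ `TracialDecayExp20` /
  `TracialDecayDimBal` (all `r²n < e^{a·dq n}`)" of `Literature.Combinatorics.Optimization.TracialDesigns`
  that adds to the rectangle bound ONLY the exact nonnegativity of each column on squares of degree below
  (half) the column's own degree (Grigoriev positivity of the matching pseudo-expectation, cell brick 84b),
  used as a black box: such a step is an instance of `RectangleBoundLiftsLowDegPsd C` with `C(r)·e^{−a₁·dq n}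
  ≤ e^{−a·dq n}/2` up to `r ≈ e^{a·dq n/2}`, impossible by `liftConstant_ge_exp`; the polynomial case is
  `not_rectangleBoundLiftsLowDegPsd_poly`. Together with the first file: (P2) alone fails
  (`not_rectangleBoundLifts_poly`), (P1)+(P2) fail, and (P1) alone is no one-sided hypothesis at all —
  it holds column by column for the pseudo-expectations of INFEASIBLE systems up to degree `Ω(n)`
  (Tseitin and the parity principle [cite: Grigoriev2001TCS, Corollary 1 and Corollary 2 (PC> refutations of Tseitin / MOD2 need degree > Ω(k))];
  the knapsack [cite: Grigoriev2001, Lemma 1.4 (PDF p. 8)]), and the parity polytope has exponentially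
  many facets yet is the projection of an `O(n²)`-size LP
  [cite: Yannakakis1991, §2, Examples: parity polytope (p. 444)] — exact low-degree positivity carries no
  one-sided or rank information by itself.
because: squares of degree-`≤ d` functions in `Z` have no component along the top parity `u` when
  `2d < k` [cite: ODonnell2014, Thm. 1.5], so twisting the rewarded diagonal `−[A = B]` of the
  Frankl–Wilson kernel by `u(Z)` makes every column exactly psd on them (P1) at no cost to (P2) — a
  rectangle is rewarded only on even fibres, i.e. through a fractional Frankl–Wilson rectangle
  [cite: FranklWilson1981, Thm. 2 and §3] [cite: Rothvoss2017, Lemma 5 (proof, PDF p. 6)] — while the contraction player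
  simply plays the BCW projections on the even fibre and `0` on the odd one
  [cite: BuhrmanCleveWigderson1998, §3], a strategy of `Z`-degree `k`, outside the range certified by (P1).
evasions_known: (i) USE THE WINDOW: the violation lives entirely in the degrees `(2d, k]` between the
  positivity range and the kernel's top degree; an argument for the cell must control the design weight's
  columns in the window `(dq n, 2·dq n]` of cut-degree (where Grigoriev positivity is silent) by their
  explicit form (`levelWeight` is a fixed univariate polynomial in `|δ(U) ∩ M|`), not by positivity.
  (ii) LOW DEGREE IN ALL STRATEGY VARIABLES: here the base factor `[A = B]`, `[|A ∩ B| = p−1]` has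
  degree `≈ 2p = r/2` in the `±1`-coordinates of `A` (total column degree `q ≈ r/2 + k`), whereas the
  cell's columns have cut-degree `q = 2·dq n` with `r < e^{a·q/4}` throughout the budget (`r` exponential
  in `q`, at the small rate `a/4`); a lifting principle with loss `e^{c·q}` for columns of TOTAL degree
  `q` (useful to the cell iff `c` is small against the rectangle-decay rate) is neither refuted here nor in
  print ("none published"; the printed degree-to-rank bridge
  [cite: LeeRaghavendraSteurer2015, Thm. 2.2 and Thm. 1.8] is two-sided and gadget-based, see the first
  file). (iii) The first file's (ii)–(iii) apply verbatim.
scope_caveats: refutes the ABSTRACT principle quantified over all kernels of the stated shape; says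
  nothing about `levelWeight`. NOT covered: kernels whose columns have low degree in ALL variables the
  strategies may depend on (evasion (ii)); positivity ranges `≥` half the kernel's top degree in the
  twisted block (the construction needs `2d < k`; with a degree-`2d` twist (P1) fails); non-prime `p`;
  small dimension (`p ≤ 3`, `r ≤ 12`, ratio `≤ 1`). The (P1) hypothesis is imposed column-wise on the
  cube block only (arbitrary dependence on the base point is allowed in the test functions `s`, which only
  strengthens the hypothesis and hence the barrier). Constants as in the first file (`(3/2)^p/(4p)` not
  sharp).
status: established (Frankl–Wilson 1981, Buhrman–Cleve–Wigderson 1998, character orthogonality; this file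
  is a complete proof, axioms standard).
-/

noncomputable section

open Finset Matrix

namespace Literature.Barriers.PneNP

namespace RectanglePositivityNoLiftLowDegree

open RectanglePositivityNoLift

/-! ### §1 Walsh characters on an auxiliary cube and the parity involution -/

/-- The auxiliary Boolean cube `{0,1}^k`, as subsets of `Fin k`. [folklore] -/
abbrev Cube (k : ℕ) : Type := Finset (Fin k)

variable {k : ℕ}

/-- The Walsh character `χ_T(Z) = (−1)^{|T ∩ Z|}`. [cite: ODonnell2014, Def. 1.2 (§1.2, the characters χ_S)] -/
def chi (T Z : Cube k) : ℝ := (-1) ^ (T ∩ Z).card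

/-- The full parity `u(Z) = (−1)^{|Z|} = χ_{[k]}(Z)`. [cite: ODonnell2014, Def. 1.2 (§1.2)] -/
def parity (Z : Cube k) : ℝ := (-1) ^ Z.card

/-- `u(Z)² = 1`. [folklore] -/
private theorem parity_sq (Z : Cube k) : parity Z ^ 2 = 1 := by
  unfold parity; rw [← pow_mul]; exact Even.neg_one_pow ⟨Z.card, by ring⟩

/-- `u(Z) = 1` or `u(Z) = −1`. [folklore] -/
private theorem parity_eq_or (Z : Cube k) : parity Z = 1 ∨ parity Z = -1 := by
  unfold parity
  rcases Nat.even_or_odd Z.card with h | h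
  · exact Or.inl h.neg_one_pow
  · exact Or.inr h.neg_one_pow

/-- The flip of one coordinate. [folklore] -/
private def flip (i : Fin k) (Z : Cube k) : Cube k := if i ∈ Z then Z.erase i else insert i Z

/-- Flipping twice is the identity. [folklore] -/
private theorem flip_flip (i : Fin k) (Z : Cube k) : flip i (flip i Z) = Z := by
  unfold flip
  by_cases h : i ∈ Z
  · rw [if_pos h, if_neg (Finset.notMem_erase i Z), Finset.insert_erase h]
  · rw [if_neg h, if_pos (Finset.mem_insert_self i Z), Finset.erase_insert h]

/-- A flip moves every point. [folklore] -/
private theorem flip_ne (i : Fin k) (Z : Cube k) : flip i Z ≠ Z := by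
  unfold flip
  by_cases h : i ∈ Z
  · rw [if_pos h]; intro hZ; rw [← hZ] at h; exact Finset.notMem_erase i Z h
  · rw [if_neg h]; intro hZ; rw [← hZ] at h; exact h (Finset.mem_insert_self i Z)

/-- A flip changes the sign of the parity. [folklore] -/
private theorem parity_flip (i : Fin k) (Z : Cube k) : parity (flip i Z) = -parity Z := by
  unfold flip parity
  by_cases h : i ∈ Z
  · rw [if_pos h, Finset.card_erase_of_mem h]
    have hc : 1 ≤ Z.card := Finset.card_pos.2 ⟨i, h⟩
    conv_rhs => rw [show Z.card = Z.card - 1 + 1 by omega, pow_succ]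
    ring
  · rw [if_neg h, Finset.card_insert_of_notMem h, pow_succ]; ring

/-- A flip outside `T` does not change `χ_T`. [folklore] -/
private theorem chi_flip {T : Cube k} {i : Fin k} (hi : i ∉ T) (Z : Cube k) :
    chi T (flip i Z) = chi T Z := by
  unfold flip chi
  congr 2
  by_cases h : i ∈ Z
  · rw [if_pos h, Finset.inter_erase, Finset.erase_eq_of_notMem]
    exact fun hm => hi (Finset.mem_inter.1 hm).1
  · rw [if_neg h]
    ext x
    simp only [Finset.mem_inter, Finset.mem_insert]
    constructor
    · rintro ⟨hxT, hx | hx⟩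
      · exact absurd hxT (hx ▸ hi)
      · exact ⟨hxT, hx⟩
    · rintro ⟨hxT, hx⟩; exact ⟨hxT, Or.inr hx⟩

/-- **Parity orthogonality**: `Σ_Z u(Z)·χ_T(Z)·χ_{T'}(Z)·w = 0` whenever some coordinate lies outside
`T ∪ T'` (flip it: the characters are unchanged, the parity changes sign). [cite: ODonnell2014, Thm. 1.5 (orthonormality of the characters)] -/
theorem sum_parity_mul_chi_mul_chi_eq_zero {T T' : Cube k} {i : Fin k} (hT : i ∉ T) (hT' : i ∉ T')
    (w : ℝ) : ∑ Z : Cube k, parity Z * chi T Z * chi T' Z * w = 0 := by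
  classical
  refine Finset.sum_ninvolution (flip i) (fun Z => ?_) (fun Z _ => flip_ne i Z) (fun Z => Finset.mem_univ _)
    (fun Z => flip_flip i Z)
  rw [parity_flip, chi_flip hT, chi_flip hT']
  ring

/-! ### §2 Low-degree functions in the auxiliary variable and the exact positivity of the kernel's columns -/

/-- `s : α₀ × {0,1}^k → ℝ` has DEGREE `≤ d` IN THE CUBE VARIABLE: for every base point, `Z ↦ s(a,Z)` is a
linear combination of characters `χ_T` with `|T| ≤ d` (coefficients may depend on `a` arbitrarily).
[cite: ODonnell2014, Thm. 1.1 (multilinear expansion) and §1.4, Def. 1.19 (degree = level |S|; weight at degree k)] -/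
def IsLowDeg {α₀ : Type*} (d : ℕ) (s : α₀ × Cube k → ℝ) : Prop :=
  ∀ a, ∃ c : Cube k → ℝ, (∀ T, d < T.card → c T = 0) ∧ ∀ Z, s (a, Z) = ∑ T, c T * chi T Z

/-- **Squares of low-degree functions are orthogonal to the top parity**: if `2d < k` and `s` has
cube-degree `≤ d`, then `Σ_Z u(Z)·s(a,Z)² = 0` for every base point `a`.
[cite: ODonnell2014, Thm. 1.5 and Fact 1.6 (χ_T·χ_{T'} = χ_{T△T'}, |T△T'| ≤ 2d < k ⇒ ⟨χ_T χ_{T'}, χ_{[k]}⟩ = 0)] -/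
theorem sum_parity_mul_sq_eq_zero {α₀ : Type*} {d : ℕ} (hdk : 2 * d < k) {s : α₀ × Cube k → ℝ}
    (hs : IsLowDeg d s) (a : α₀) : ∑ Z : Cube k, parity Z * s (a, Z) ^ 2 = 0 := by
  classical
  obtain ⟨c, hc, hsZ⟩ := hs a
  have e : ∀ Z : Cube k, parity Z * s (a, Z) ^ 2 =
      ∑ T, ∑ T', parity Z * chi T Z * chi T' Z * (c T * c T') := by
    intro Z
    rw [hsZ, sq, Finset.sum_mul_sum, Finset.mul_sum]
    refine Finset.sum_congr rfl fun T _ => ?_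
    rw [Finset.mul_sum]
    exact Finset.sum_congr rfl fun T' _ => by ring
  simp_rw [e]
  rw [Finset.sum_comm]
  refine Finset.sum_eq_zero fun T _ => ?_
  rw [Finset.sum_comm]
  refine Finset.sum_eq_zero fun T' _ => ?_
  by_cases hT : d < T.card
  · simp [hc T hT]
  by_cases hT' : d < T'.card
  · simp [hc T' hT']
  push Not at hT hT'
  -- a coordinate outside T ∪ T'
  have hcard : (T ∪ T').card < Fintype.card (Fin k) := by
    rw [Fintype.card_fin]
    exact lt_of_le_of_lt (Finset.card_union_le T T') (by omega)
  obtain ⟨i, -, hi⟩ := Finset.exists_mem_notMem_of_card_lt_card (s := T ∪ T') (t := Finset.univ)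
    (by rwa [Finset.card_univ])
  rw [Finset.mem_union, not_or] at hi
  exact sum_parity_mul_chi_mul_chi_eq_zero hi.1 hi.2 (c T * c T')

/-! ### §3 The kernel: Frankl–Wilson's orthogonality game with the diagonal twisted by the parity -/

variable {p : ℕ}

/-- The kernel on (Layer × {0,1}^k) × Layer: `V((A,Z), B) = −[A = B]·u(Z) + ½·[A ⟂ B]` — the rewarded
diagonal now carries the sign of the top parity of the auxiliary variable, the penalty is unchanged.
[cite: FranklWilson1981, Thm. 2 and §3] [cite: BuhrmanCleveWigderson1998, Thm. 6 and §3] -/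
def ldKernel (x : Layer p × Cube k) (B : Layer p) : ℝ :=
  -(if x.1 = B then parity x.2 else 0) + (1 / 2) * (if Orth x.1 B then 1 else 0)

/-- **(P1) EXACT COLUMN-WISE LOW-DEGREE POSITIVITY.** For every column `B` and every `s` of cube-degree
`≤ d` with `2d < k`: `Σ_x V(x,B)·s(x)² ≥ 0` — indeed `= ½·Σ_{A ⟂ B} Σ_Z s(A,Z)²`, the twisted diagonal
being invisible to squares of low-degree functions. [cite: ODonnell2014, Thm. 1.5 and Fact 1.6]
[cite: Grigoriev2001, Lemma 1.4 (PDF p. 8) (the positivity shape: a pseudo-expectation is ≥ 0 on low-degree squares)] -/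
theorem column_lowDeg_psd [Fact p.Prime] {d : ℕ} (hdk : 2 * d < k) (B : Layer p)
    {s : Layer p × Cube k → ℝ} (hs : IsLowDeg d s) :
    0 ≤ ∑ x : Layer p × Cube k, ldKernel x B * s x ^ 2 := by
  classical
  rw [Fintype.sum_prod_type]
  refine Finset.sum_nonneg fun A _ => ?_
  have hio : (0 : ℝ) ≤ (if Orth A B then 1 else 0) := by split_ifs <;> norm_num
  by_cases hA : A = B
  · have e : ∀ Z : Cube k, ldKernel (A, Z) B * s (A, Z) ^ 2 =
        -(parity Z * s (A, Z) ^ 2) + (1 / 2) * (if Orth A B then 1 else 0) * s (A, Z) ^ 2 := by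
      intro Z
      unfold ldKernel
      dsimp only
      rw [if_pos hA]
      ring
    simp_rw [e]
    rw [Finset.sum_add_distrib, Finset.sum_neg_distrib, sum_parity_mul_sq_eq_zero hdk hs A, neg_zero,
      zero_add]
    exact Finset.sum_nonneg fun Z _ => mul_nonneg (mul_nonneg (by norm_num) hio) (sq_nonneg _)
  · have e : ∀ Z : Cube k, ldKernel (A, Z) B * s (A, Z) ^ 2 =
        (1 / 2) * (if Orth A B then 1 else 0) * s (A, Z) ^ 2 := by
      intro Z
      unfold ldKernel
      dsimp only
      rw [if_neg hA]
      ring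
    simp_rw [e]
    exact Finset.sum_nonneg fun Z _ => mul_nonneg (mul_nonneg (by norm_num) hio) (sq_nonneg _)

/-! ### §4 (P2) The rectangle bound survives the twist -/

/-- Mass of the even (parity `+1`) sub-cube: `W₊ = #{Z : u(Z) = 1}` as a real; `W₊ ≥ 1` (`Z = ∅`).
[folklore] -/
def evenMass (k : ℕ) : ℝ := ∑ Z : Cube k, if parity Z = 1 then (1 : ℝ) else 0

/-- `W₊ ≥ 1` (the empty set is even). [folklore] -/
private theorem one_le_evenMass : 1 ≤ evenMass k := by
  classical
  unfold evenMass
  have h := Finset.single_le_sum (s := Finset.univ)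
    (f := fun Z : Cube k => if parity Z = 1 then (1 : ℝ) else 0)
    (fun Z _ => by split_ifs <;> norm_num) (Finset.mem_univ (∅ : Cube k))
  have h0 : (if parity (∅ : Cube k) = 1 then (1 : ℝ) else 0) = 1 := by simp [parity]
  rw [h0] at h
  exact h

/-- **(P2) ONE-SIDED RECTANGLE BOUND** for the twisted kernel: every combinatorial rectangle
`S × T ⊆ (Layer × {0,1}^k) × Layer` has `V`-sum `≥ −W₊·C(4p, p−1)`. (Per base point only the even
fibre of `S` can be charged negatively; what remains is a fractional Frankl–Wilson rectangle,
`RectanglePositivityNoLift.frac_rect_sum_ge`.) [cite: FranklWilson1981, Thm. 2 and §3]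
[cite: Rothvoss2017, Lemma 5 (proof: fractional rank-1 matrices reduce to 0/1 rectangles; PDF p. 6)] -/
theorem rect_sum_ge [hp : Fact p.Prime] (S : Finset (Layer p × Cube k)) (T : Finset (Layer p)) :
    -(evenMass k * ((4 * p).choose (p - 1) : ℝ)) ≤ ∑ x ∈ S, ∑ B ∈ T, ldKernel x B := by
  classical
  -- n_A = number of even Z with (A,Z) ∈ S;  f A = n_A / W₊ ∈ [0,1];  g = 1_T
  set n : Layer p → ℝ := fun A => ∑ Z : Cube k, if ((A, Z) ∈ S ∧ parity Z = 1) then (1 : ℝ) else 0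
    with hn
  have hW : 0 < evenMass k := lt_of_lt_of_le one_pos one_le_evenMass
  have hn0 : ∀ A, 0 ≤ n A := fun A => Finset.sum_nonneg fun Z _ => by split_ifs <;> norm_num
  have hnW : ∀ A, n A ≤ evenMass k := by
    intro A
    unfold evenMass
    exact Finset.sum_le_sum fun Z _ => by
      by_cases h1 : parity Z = 1 <;> by_cases h2 : (A, Z) ∈ S <;> simp [h1, h2]
  -- Step 1: termwise lower bound V(x,B) ≥ [u = 1]·fwKernel(x.1, B) on pairs, in summed form
  have step1 : ∀ (x : Layer p × Cube k) (B : Layer p),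
      (if parity x.2 = 1 then (1 : ℝ) else 0) * fwKernel x.1 B ≤ ldKernel x B := by
    rintro ⟨A, Z⟩ B
    unfold fwKernel ldKernel
    dsimp only
    by_cases hA : A = B
    · rw [if_pos hA, if_pos hA]
      by_cases hO : Orth A B
      · rw [if_pos hO]; rcases parity_eq_or Z with h | h <;> rw [h] <;> norm_num
      · rw [if_neg hO]; rcases parity_eq_or Z with h | h <;> rw [h] <;> norm_num
    · rw [if_neg hA, if_neg hA]
      by_cases hO : Orth A B
      · rw [if_pos hO]; rcases parity_eq_or Z with h | h <;> rw [h] <;> norm_num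
      · rw [if_neg hO]; rcases parity_eq_or Z with h | h <;> rw [h] <;> norm_num
  have step1' : ∑ x ∈ S, ∑ B ∈ T, (if parity x.2 = 1 then (1 : ℝ) else 0) * fwKernel x.1 B ≤
      ∑ x ∈ S, ∑ B ∈ T, ldKernel x B :=
    Finset.sum_le_sum fun x _ => Finset.sum_le_sum fun B _ => step1 x B
  refine le_trans ?_ step1'
  -- Step 2: regroup the left side as W₊ · Σ_A Σ_B fwKernel A B · f A · g B
  have step2 : ∑ x ∈ S, ∑ B ∈ T, (if parity x.2 = 1 then (1 : ℝ) else 0) * fwKernel x.1 B =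
      ∑ A : Layer p, ∑ B : Layer p, fwKernel A B * (n A * (if B ∈ T then (1 : ℝ) else 0)) := by
    have e1 : ∑ x ∈ S, ∑ B ∈ T, (if parity x.2 = 1 then (1 : ℝ) else 0) * fwKernel x.1 B =
        ∑ x : Layer p × Cube k, (if x ∈ S then
          ∑ B ∈ T, (if parity x.2 = 1 then (1 : ℝ) else 0) * fwKernel x.1 B else 0) := by
      rw [← Finset.sum_filter]; congr 1; ext x; simp
    rw [e1, Fintype.sum_prod_type]
    refine Finset.sum_congr rfl fun A _ => ?_
    -- inner: Σ_Z [..] Σ_{B∈T} [u=1] K(A,B) = Σ_B K(A,B) · n_A · 1_T(B)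
    have e2 : ∀ Z : Cube k, (if (A, Z) ∈ S then
        ∑ B ∈ T, (if parity Z = 1 then (1 : ℝ) else 0) * fwKernel A B else 0) =
        (if ((A, Z) ∈ S ∧ parity Z = 1) then (1 : ℝ) else 0) * ∑ B ∈ T, fwKernel A B := by
      intro Z
      by_cases h1 : (A, Z) ∈ S <;> by_cases h2 : parity Z = 1 <;> simp [h1, h2, Finset.mul_sum]
    simp_rw [e2]
    rw [← Finset.sum_mul]
    -- Σ_{B∈T} K = Σ_B K · 1_T
    have eT : ∑ B ∈ T, fwKernel A B = ∑ B : Layer p, fwKernel A B * (if B ∈ T then (1:ℝ) else 0) :=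
      calc ∑ B ∈ T, fwKernel A B = ∑ B ∈ Finset.univ ∩ T, fwKernel A B := by rw [Finset.univ_inter]
        _ = ∑ B : Layer p, (if B ∈ T then fwKernel A B else 0) := (Finset.sum_ite_mem _ _ _).symm
        _ = ∑ B : Layer p, fwKernel A B * (if B ∈ T then (1:ℝ) else 0) :=
          Finset.sum_congr rfl fun B _ => by by_cases hB : B ∈ T <;> simp [hB]
    rw [eT]
    rw [Finset.mul_sum]
    exact Finset.sum_congr rfl fun B _ => by rw [hn]; ring
  rw [step2]
  -- Step 3: the fractional Frankl–Wilson bound with f = n/W₊, g = 1_T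
  have h3 := RectanglePositivityNoLift.frac_rect_sum_ge (p := p) (fun A => n A / evenMass k)
    (fun B => if B ∈ T then (1 : ℝ) else 0)
    (fun A => ⟨div_nonneg (hn0 A) hW.le, (div_le_one hW).2 (hnW A)⟩)
    (fun B => by split_ifs <;> norm_num)
  have e4 : ∑ A : Layer p, ∑ B : Layer p, fwKernel A B * (n A * (if B ∈ T then (1 : ℝ) else 0)) =
      evenMass k * ∑ A : Layer p, ∑ B : Layer p,
        fwKernel A B * (n A / evenMass k * (if B ∈ T then (1 : ℝ) else 0)) := by
    rw [Finset.mul_sum]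
    refine Finset.sum_congr rfl fun A _ => ?_
    rw [Finset.mul_sum]
    refine Finset.sum_congr rfl fun B _ => ?_
    field_simp
  rw [e4]
  nlinarith [h3, hW]

/-! ### §5 The high-degree contraction strategy -/

/-- The cut-side field: the Frankl–Wilson projection `X_A` on the EVEN fibre, `0` on the odd fibre — a
psd contraction of dimension `4p` whose dependence on the auxiliary variable is the top parity
(degree `k`, above every `2d < k`). [cite: BuhrmanCleveWigderson1998, §3] -/
def ldProjX (x : Layer p × Cube k) : Matrix (Fin (4 * p)) (Fin (4 * p)) ℝ :=
  if parity x.2 = 1 then fwProj x.1 else 0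

/-- `0 ⪯ X_x ⪯ I`. [cite: BuhrmanCleveWigderson1998, §3] -/
theorem ldProjX_contraction [Fact p.Prime] (x : Layer p × Cube k) :
    (ldProjX x).PosSemidef ∧ (1 - ldProjX x).PosSemidef := by
  unfold ldProjX
  split_ifs
  · exact ⟨fwProj_posSemidef x.1, one_sub_fwProj_posSemidef x.1⟩
  · rw [sub_zero]; exact ⟨Matrix.PosSemidef.zero, Matrix.PosSemidef.one⟩

/-- **Value of the strategy**: `Σ_{x,B} V(x,B)·tr(X_x Y_B) = −W₊·C(4p, 2p−1)` with `Y_B = fwProj B`: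
every even-fibre diagonal term costs `−1`, penalised pairs are orthogonal, the odd fibre is switched off.
[cite: BuhrmanCleveWigderson1998, Thm. 6 and §3] -/
theorem contraction_value [hp : Fact p.Prime] :
    ∑ x : Layer p × Cube k, ∑ B : Layer p, ldKernel x B * (ldProjX x * fwProj B).trace =
      -(evenMass k * ((4 * p).choose (2 * p - 1) : ℝ)) := by
  classical
  have e : ∀ (x : Layer p × Cube k) (B : Layer p), ldKernel x B * (ldProjX x * fwProj B).trace =
      -((if parity x.2 = 1 then (1 : ℝ) else 0) * (if x.1 = B then (1 : ℝ) else 0)) := by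
    intro x B
    unfold ldKernel ldProjX
    by_cases hpar : parity x.2 = 1
    · rw [if_pos hpar, if_pos hpar, hpar]
      by_cases hA : x.1 = B
      · rw [if_pos hA, hA]
        have h2 := hp.out.two_le
        have hp0 : (p : ℝ) ≠ 0 := by exact_mod_cast hp.out.ne_zero
        have hO : ¬ Orth B B := by
          unfold Orth; rw [Finset.inter_self, B.2]; omega
        rw [if_neg hO, trace_fwProj_mul_eq, Finset.inter_self, B.2, Nat.cast_sub (by omega)]
        push_cast
        field_simp
        ring
      · rw [if_neg hA]
        by_cases hO : Orth x.1 B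
        · rw [if_pos hO, trace_fwProj_mul_of_orth hO]; ring
        · rw [if_neg hO]; ring
    · rw [if_neg hpar, if_neg hpar, Matrix.zero_mul, Matrix.trace_zero]; ring
  simp_rw [e, Finset.sum_neg_distrib, Fintype.sum_prod_type]
  congr 1
  have inner : ∀ A : Layer p, ∑ Z : Cube k, ∑ B : Layer p,
      (if parity Z = 1 then (1 : ℝ) else 0) * (if A = B then (1 : ℝ) else 0) = evenMass k := by
    intro A
    unfold evenMass
    refine Finset.sum_congr rfl fun Z _ => ?_
    rw [← Finset.mul_sum, Finset.sum_ite_eq, if_pos (Finset.mem_univ _), mul_one]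
  have card_layer : Fintype.card (Layer p) = (4 * p).choose (2 * p - 1) := by
    rw [Fintype.card_finset_len, Fintype.card_fin]
  rw [Finset.sum_congr rfl fun A _ => inner A, Finset.sum_const, Finset.card_univ, card_layer,
    nsmul_eq_mul, mul_comm]

/-! ### §6 The strengthened technique class and the barrier -/

/-- TECHNIQUE CLASS: **kernel-agnostic one-sided lifting ASSISTED BY column-wise exact low-degree
positivity**. For every base type `α₀`, auxiliary cube `{0,1}^k`, degree `d` with `2d < k`, every finite
`β` and every kernel `W` on `(α₀ × {0,1}^k) × β`: IF (P1) each column `W(·,b)` is nonnegative on squares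
of all functions of cube-degree `≤ d` (an exact degree-`d` pseudo-expectation condition in the auxiliary
variable) AND (P2) every 0/1 rectangle has `W`-sum `≥ −ε`, THEN every pair of psd-contraction fields of
dimension `r` has normalised value `≥ −C(r)·ε`. [cite: Grigoriev2001, Lemma 1.4 (PDF p. 8)]
[cite: FranklWilson1981, Thm. 2] [cite: BuhrmanCleveWigderson1998, Thm. 6 and §3] -/
def RectangleBoundLiftsLowDegPsd (C : ℕ → ℝ) : Prop :=
  ∀ (α₀ β : Type) [Fintype α₀] [Fintype β] [DecidableEq α₀] [DecidableEq β] (k d : ℕ), 2 * d < k →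
    ∀ (W : α₀ × Cube k → β → ℝ) (ε : ℝ),
    (∀ (b : β) (s : α₀ × Cube k → ℝ), IsLowDeg d s → 0 ≤ ∑ x, W x b * s x ^ 2) →
    (∀ (S : Finset (α₀ × Cube k)) (T : Finset β), -ε ≤ ∑ x ∈ S, ∑ b ∈ T, W x b) →
    ∀ (r : ℕ) (X : α₀ × Cube k → Matrix (Fin r) (Fin r) ℝ) (Y : β → Matrix (Fin r) (Fin r) ℝ),
      (∀ x, (X x).PosSemidef ∧ (1 - X x).PosSemidef) →
      (∀ b, (Y b).PosSemidef ∧ (1 - Y b).PosSemidef) →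
        -(C r * ε) ≤ (∑ x, ∑ b, W x b * (X x * Y b).trace) / r

/-- The plain class `RectangleBoundLifts` of the first file is contained in the assisted one (more
hypotheses, same conclusion), so every lower bound on assisted lifting constants is one on plain ones.
[cite: BuhrmanCleveWigderson1998, Thm. 6 and §3] [cite: Grigoriev2001, Lemma 1.4 (PDF p. 8)] -/
theorem rectangleBoundLiftsLowDegPsd_of_lifts {C : ℕ → ℝ} (hC : RectangleBoundLifts C) :
    RectangleBoundLiftsLowDegPsd C := by
  intro α₀ β _ _ _ _ k d _ W ε _ hrect r X Y hX hY
  classical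
  exact hC (α₀ × Cube k) β W ε hrect r X Y hX hY

/-- **BARRIER (quantitative form, for EVERY degree `d`).** Any constant of the assisted class satisfies
`C(4p) ≥ C(4p,2p−1)/(4p·C(4p,p−1))` for every prime `p` — independently of `d`: take `k = 2d+1` and the
twisted Frankl–Wilson kernel `ldKernel`. [cite: FranklWilson1981, Thm. 2 and §3]
[cite: BuhrmanCleveWigderson1998, Thm. 6 and §3] -/
theorem liftConstant_ge {C : ℕ → ℝ} (hC : RectangleBoundLiftsLowDegPsd C) (d p : ℕ) [hp : Fact p.Prime] :
    ((4 * p).choose (2 * p - 1) : ℝ) / ((4 * p : ℝ) * (4 * p).choose (p - 1)) ≤ C (4 * p) := by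
  classical
  have h2 := hp.out.two_le
  have hp0 : (0 : ℝ) < 4 * p := by have := hp.out.pos; positivity
  have hc0 : (0 : ℝ) < (4 * p).choose (p - 1) := by exact_mod_cast Nat.choose_pos (by omega)
  have hW : 0 < evenMass (2 * d + 1) := lt_of_lt_of_le one_pos one_le_evenMass
  have h := hC (Layer p) (Layer p) (2 * d + 1) d (by omega) ldKernel
    (evenMass (2 * d + 1) * ((4 * p).choose (p - 1) : ℝ))
    (fun B s hs => column_lowDeg_psd (by omega) B hs) rect_sum_ge (4 * p) ldProjX fwProj
    ldProjX_contraction (fun B => ⟨fwProj_posSemidef B, one_sub_fwProj_posSemidef B⟩)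
  rw [contraction_value] at h
  push_cast at h
  -- h : -(C(4p)·(W₊·c)) ≤ -(W₊·N)/(4p)
  rw [div_le_iff₀ (by positivity)]
  have h' : evenMass (2 * d + 1) * ((4 * p).choose (2 * p - 1) : ℝ) / (4 * p) ≤
      C (4 * p) * (evenMass (2 * d + 1) * (4 * p).choose (p - 1)) := by
    rw [neg_div] at h; linarith
  rw [div_le_iff₀ hp0] at h'
  -- cancel W₊ > 0
  have h'' : evenMass (2 * d + 1) * (((4 * p).choose (2 * p - 1) : ℝ)) ≤
      evenMass (2 * d + 1) * (C (4 * p) * ((4 * p : ℝ) * (4 * p).choose (p - 1))) := by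
    nlinarith
  exact le_of_mul_le_mul_left h'' hW

/-- Growth of the Frankl–Wilson ratio: `(3/2)^p·C(4p,p−1) ≤ C(4p,2p−1)` (termwise comparison of the
ascending factorials `(3p+1)!/(2p+1)!` and `(2p−1)!/(p−1)!`). [folklore] -/
private theorem choose_ratio_ge (p : ℕ) (hp : 1 ≤ p) :
    (3 / 2 : ℝ) ^ p * (4 * p).choose (p - 1) ≤ (4 * p).choose (2 * p - 1) := by
  have hA : (4 * p).choose (2 * p - 1) * (2 * p - 1).factorial * (2 * p + 1).factorial
      = (4 * p).factorial := by
    have := Nat.choose_mul_factorial_mul_factorial (n := 4 * p) (k := 2 * p - 1) (by omega)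
    rwa [show 4 * p - (2 * p - 1) = 2 * p + 1 by omega] at this
  have hB : (4 * p).choose (p - 1) * (p - 1).factorial * (3 * p + 1).factorial
      = (4 * p).factorial := by
    have := Nat.choose_mul_factorial_mul_factorial (n := 4 * p) (k := p - 1) (by omega)
    rwa [show 4 * p - (p - 1) = 3 * p + 1 by omega] at this
  have hC : (2 * p + 1).factorial * (2 * p + 2).ascFactorial p = (3 * p + 1).factorial := by
    have := Nat.factorial_mul_ascFactorial (2 * p + 1) p
    rwa [show 2 * p + 1 + p = 3 * p + 1 by omega] at this
  have hD : (p - 1).factorial * p.ascFactorial p = (2 * p - 1).factorial := by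
    have := Nat.factorial_mul_ascFactorial (p - 1) p
    rwa [show p - 1 + 1 = p by omega, show p - 1 + p = 2 * p - 1 by omega] at this
  have key : (4 * p).choose (2 * p - 1) * p.ascFactorial p
      = (4 * p).choose (p - 1) * (2 * p + 2).ascFactorial p := by
    have hpos : 0 < (p - 1).factorial * (2 * p + 1).factorial := by positivity
    apply Nat.eq_of_mul_eq_mul_right hpos
    calc (4 * p).choose (2 * p - 1) * p.ascFactorial p * ((p - 1).factorial * (2 * p + 1).factorial)
        = (4 * p).choose (2 * p - 1) * ((p - 1).factorial * p.ascFactorial p)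
            * (2 * p + 1).factorial := by ring
      _ = (4 * p).factorial := by rw [hD, hA]
      _ = (4 * p).choose (p - 1) * (p - 1).factorial * (3 * p + 1).factorial := hB.symm
      _ = (4 * p).choose (p - 1) * (2 * p + 2).ascFactorial p
            * ((p - 1).factorial * (2 * p + 1).factorial) := by rw [← hC]; ring
  have hcmp : (3 / 2 : ℝ) ^ p * (p.ascFactorial p : ℝ) ≤ ((2 * p + 2).ascFactorial p : ℝ) := by
    rw [Nat.ascFactorial_eq_prod_range, Nat.ascFactorial_eq_prod_range]
    push_cast
    rw [show (3 / 2 : ℝ) ^ p = ∏ _i ∈ Finset.range p, (3 / 2 : ℝ) by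
        rw [Finset.prod_const, Finset.card_range],
      ← Finset.prod_mul_distrib]
    apply Finset.prod_le_prod
    · intro i _; positivity
    · intro i hi
      have hi' : (i : ℝ) ≤ p - 1 := by
        have := Finset.mem_range.1 hi
        have : (i : ℝ) + 1 ≤ p := by exact_mod_cast this
        linarith
      linarith
  have hasc : (0 : ℝ) < (p.ascFactorial p : ℝ) := by
    have h := Nat.ascFactorial_pos (p - 1) p
    rw [show p - 1 + 1 = p by omega] at h
    exact_mod_cast h
  have keyR : ((4 * p).choose (2 * p - 1) : ℝ) * (p.ascFactorial p : ℝ)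
      = ((4 * p).choose (p - 1) : ℝ) * ((2 * p + 2).ascFactorial p : ℝ) := by
    exact_mod_cast key
  nlinarith [mul_le_mul_of_nonneg_left hcmp (Nat.cast_nonneg ((4 * p).choose (p - 1))), keyR]

/-- **BARRIER (exponential form).** `C(4p) ≥ (3/2)^p/(4p)` for every prime `p` and every constant of
the assisted class. [cite: FranklWilson1981, Thm. 2 and §3] [cite: BuhrmanCleveWigderson1998, Thm. 6 and §3] -/
theorem liftConstant_ge_exp {C : ℕ → ℝ} (hC : RectangleBoundLiftsLowDegPsd C) (p : ℕ)
    [hp : Fact p.Prime] : (3 / 2 : ℝ) ^ p / (4 * p) ≤ C (4 * p) := by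
  have h2 := hp.out.two_le
  have hp0 : (0 : ℝ) < 4 * p := by have := hp.out.pos; positivity
  have hc0 : (0 : ℝ) < (4 * p).choose (p - 1) := by exact_mod_cast Nat.choose_pos (by omega)
  refine le_trans ?_ (liftConstant_ge hC 0 p)
  rw [div_le_div_iff₀ hp0 (by positivity)]
  have := choose_ratio_ge p (by omega)
  nlinarith

/-- **BARRIER (qualitative form): no polynomial constant, even with exact low-degree positivity of every
degree.** For all `c, b`: `¬ RectangleBoundLiftsLowDegPsd (r ↦ c·r^b)`. So a proof of `TracialDecayExp20`
from NTF cannot be rescued by adding ONLY "the columns of the kernel are exact pseudo-expectations on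
squares of low degree in some of the variables" (Grigoriev-type positivity) to the rectangle bound: the
argument must use how the degree structure of the KERNEL ITSELF (not just its positivity on low-degree
squares) interacts with the strategies — see the module docstring.
[cite: FranklWilson1981, Thm. 2 and §3] [cite: BuhrmanCleveWigderson1998, Thm. 6 and §3] -/
theorem not_rectangleBoundLiftsLowDegPsd_poly (c : ℝ) (b : ℕ) :
    ¬ RectangleBoundLiftsLowDegPsd (fun r => c * (r : ℝ) ^ b) := by
  intro hC
  have hlim := tendsto_pow_const_div_const_pow_of_one_lt (b + 1) (r := (3 / 2 : ℝ)) (by norm_num)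
  have hev : ∀ᶠ n : ℕ in Filter.atTop,
      (n : ℝ) ^ (b + 1) / (3 / 2 : ℝ) ^ n < 1 / (|c| * 4 ^ (b + 1) + 1) :=
    Filter.Tendsto.eventually_lt_const (by positivity) hlim
  obtain ⟨N, hN⟩ := Filter.eventually_atTop.1 hev
  obtain ⟨p, hpN, hprime⟩ := Nat.exists_infinite_primes (max N 2)
  haveI : Fact p.Prime := ⟨hprime⟩
  have hp2 : 2 ≤ p := le_trans (le_max_right _ _) hpN
  have hpR : (2 : ℝ) ≤ p := by exact_mod_cast hp2
  have h1 := liftConstant_ge_exp hC p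
  have h3 := hN p (le_trans (le_max_left _ _) hpN)
  have hq : (0 : ℝ) < (3 / 2 : ℝ) ^ p := by positivity
  have hK : (0 : ℝ) < |c| * 4 ^ (b + 1) + 1 := by positivity
  rw [div_lt_iff₀ hq] at h3
  rw [div_le_iff₀ (by positivity)] at h1
  have h4 : (3 / 2 : ℝ) ^ p ≤ |c| * 4 ^ (b + 1) * (p : ℝ) ^ (b + 1) := by
    have : c * ((4 : ℝ) * p) ^ b * (4 * p) ≤ |c| * 4 ^ (b + 1) * (p : ℝ) ^ (b + 1) := by
      have e : c * ((4 : ℝ) * p) ^ b * (4 * p) = c * (4 ^ (b + 1) * (p : ℝ) ^ (b + 1)) := by ring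
      rw [e]
      have := le_abs_self c
      nlinarith [pow_pos (show (0:ℝ) < 4 by norm_num) (b + 1), pow_pos (show (0:ℝ) < p by linarith) (b + 1),
        mul_pos (pow_pos (show (0:ℝ) < 4 by norm_num) (b + 1)) (pow_pos (show (0:ℝ) < p by linarith) (b + 1))]
    push_cast at h1
    linarith
  have h5 : |c| * 4 ^ (b + 1) * (p : ℝ) ^ (b + 1) + (p : ℝ) ^ (b + 1) < (3 / 2 : ℝ) ^ p := by
    have h6 : (p : ℝ) ^ (b + 1) * (|c| * 4 ^ (b + 1) + 1) <
        1 / (|c| * 4 ^ (b + 1) + 1) * (3 / 2 : ℝ) ^ p * (|c| * 4 ^ (b + 1) + 1) :=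
      mul_lt_mul_of_pos_right h3 hK
    have e : 1 / (|c| * 4 ^ (b + 1) + 1) * (3 / 2 : ℝ) ^ p * (|c| * 4 ^ (b + 1) + 1)
        = (3 / 2 : ℝ) ^ p := by
      field_simp
    rw [e] at h6
    linarith
  have hp1 : (0 : ℝ) < (p : ℝ) ^ (b + 1) := by positivity
  linarith

end RectanglePositivityNoLiftLowDegree

end Literature.Barriers.PneNP
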